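/-
Copyright (c) 2026. All rights reserved.
Released under Apache 2.0 license as described in the file LICENSE.
Authors: HodgeCM publication cell (pub-hodgecm), GR lane, seat GR-1 (`pub-hodgecm-own-real34`).
-/
import Literature.NumberTheory.GelbartRogawski1991.DoubledUnitaryArchSiegelDiagonalModulusGen
import HarnessLib

/-!
# The archimedean Siegel element `(g, 1)` on diagonal pairs — general `E/F`, `E` WITH real places allowed:
# `det_ℝ = (∏_{w real} sign det α_w) · |det_Δ (g,1)|_{𝔸_E}` (the SIGNED modulus input `hdiagS`)

Topic `NumberTheory/GelbartRogawski1991`; namespace `Literature.NumberTheory.GelbartRogawski1991.GRConstructionGen`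
(telescope `(F E c hcδ hδ hd e TV hV hVd TW hW hWd)`).  KERNEL only: proved theorems; no definition, no named fact,
no `sorry`.  Sequel of `DoubledUnitaryArchSiegelDiagonalModulusGen` (`exists_archAct_diagPair_det_eq_modDelta_sq_gen`,
`E` totally complex: `0 < det A = modDelta²`), dropping `IsTotallyComplex E`:

* §1 `prod_norm_pow_mult_eq_prod_abs_mul_prod_normSq` — `|y|_{E ⊗ ℝ} = ∏_{w real} |σ_w(y_w)| · ∏_{w complex} |σ_w(y_w)|²`
  for ANY number field `E` (local degrees `1` and `2`); `det_archMat_fst` — the real-place components of `det G_∞`;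
  **`modDelta_archToAdelic_sq_eq_prod`** — `modDelta (g,1)² = ∏_{w real} |det α_w| · ∏_{w complex} |det σ_w(α_w)|²`,
  `α = deltaBlock (g,1)`;
* §2 **`exists_archAct_diagPair_det_eq_sign_mul_modDelta_sq`** — THE SIGNED MODULUS INPUT `hdiagS` of
  `DoubledWeilRepresentationArchLiftReps.isArchHalf_twist_archLift_of_reps` at `jA := archToAdelic`: for `g ∈ U(J^𝔻)(F ⊗ ℝ)`
  with `(g,1) ∈ P_Δ(𝔸)` the diagonal action `A = archResLin (deltaBlock (g,1))` satisfies
  `det A = (∏_{w real} sign (det α_w)) · modDelta (g,1)²` — i.e. `sgnA g = ∏_{w real} sign (det α_w)`, the product of the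
  signs of the determinants of `g` on `Δ_w` over the REAL places `w` of `E` (empty product `1` for `E` totally complex,
  recovering the totally complex statement); `sign_prod_eq` — this sign is `±1`.

([Kudla1994, §3], incl. the case `E_v = F_v ⊕ F_v`; [HarrisKudlaSweet1996, §1 (1.15)]; archimedean places of type (ii)
of [GelbartRogawski1991, Prop. 3.1.1].)  Written for the stage-1 cell `pub-hodgecm` (seat GR-1); nothing here is a
claim of the manuscripts adjudicated by that cell.

## References

* S. S. Kudla, Israel J. Math. 87 (1994) 361–401, §3 [Kudla1994].
* M. Harris, S. S. Kudla, W. J. Sweet, J. Amer. Math. Soc. 9 (1996), §1 (1.15) [HarrisKudlaSweet1996].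
* S. Gelbart, J. Rogawski, Invent. Math. 105 (1991), §3.1 Prop. 3.1.1 p. 455 [GelbartRogawski1991].
* J. Tate, *Fourier analysis in number fields and Hecke's zeta-functions* (1950/1967), §4.3 [TateThesis1967].
-/

set_option autoImplicit false

noncomputable section

open scoped Classical
open scoped Matrix
open NumberField NumberField.InfinitePlace NumberField.mixedEmbedding IsDedekindDomain
open Literature.NumberTheory.Automorphic Literature.NumberTheory.Automorphic.UnitaryGroup
open Literature.NumberTheory.Weil1964
open Literature.NumberTheory.GaloisRepresentations
open Literature.RepresentationTheory.HeisenbergGroup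

namespace Literature.NumberTheory.GelbartRogawski1991.GRConstructionGen

open UnitaryDualPair QuadraticCoordinates

variable (F : Type) [Field F] [NumberField F] (E : Type) [Field E] [NumberField E] [Algebra F E]
  [Algebra.IsQuadraticExtension F E]
variable (c : E ≃ₐ[F] E) {δ : E} (hcδ : c δ = -δ) (hδ : δ ≠ 0) {d : F} (hd : δ * δ = algebraMap F E d)
variable {N M n : ℕ} (e : Fin N × Fin M ≃ Fin n)
  (TV : Matrix (Fin N) (Fin N) F) (hV : TV.IsSymm) (hVd : IsUnit TV.det)
  (TW : Matrix (Fin M) (Fin M) F) (hW : TW.IsSymm) (hWd : IsUnit TW.det)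

/-! ## §1 The idelic modulus `|det_Δ (g,1)|_{𝔸_E}` for a general `E` -/

omit [NumberField F] [Algebra.IsQuadraticExtension F E] in
/-- **`|y|_{E ⊗ ℝ} = ∏_{w real} |σ_w(y_w)| · ∏_{w complex} |σ_w(y_w)|²`** for ANY number field `E` (local degrees `1` at the
real and `2` at the complex places; `σ_w` is an isometry). [cite: TateThesis1967, §4.3] -/
theorem prod_norm_pow_mult_eq_prod_abs_mul_prod_normSq (y : InfiniteAdeleRing E) :
    ∏ w : InfinitePlace E, ‖y w‖ ^ w.mult =
      (∏ w : {w : InfinitePlace E // w.IsReal}, |Completion.extensionEmbeddingOfIsReal w.2 (y w.1)|) *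
        ∏ w : {w : InfinitePlace E // w.IsComplex}, Complex.normSq (Completion.extensionEmbedding w.1 (y w.1)) := by
  rw [← Fintype.prod_subtype_mul_prod_subtype (fun w : InfinitePlace E => w.IsReal)]
  congr 1
  · refine Finset.prod_congr rfl fun w _ => ?_
    rw [mult_isReal, pow_one, ← Real.norm_eq_abs,
      (Completion.isometry_extensionEmbeddingOfIsReal w.2).norm_map_of_map_zero (map_zero _)]
  · refine Fintype.prod_equiv (Equiv.subtypeEquivRight fun w => not_isReal_iff_isComplex) _ _ fun w => ?_
    have hw : IsComplex w.1 := not_isReal_iff_isComplex.1 w.2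
    change ‖y w.1‖ ^ (w.1).mult = Complex.normSq (Completion.extensionEmbedding w.1 (y w.1))
    rw [mult_isComplex ⟨w.1, hw⟩, Complex.normSq_eq_norm_sq,
      (Completion.isometry_extensionEmbedding w.1).norm_map_of_map_zero (map_zero _)]

omit [NumberField F] [Algebra F E] [Algebra.IsQuadraticExtension F E] in
/-- **the real-place components of `det G_∞`**: `((archMat G).det)_w = σ_w((det G)_w)` at a real place `w` of `E`
(`archMat` is `RingHom.mapMatrix` of the archimedean projection read in the mixed space). [cite: Kudla1994, §3] -/
theorem det_archMat_fst {k : Type} [Fintype k] [DecidableEq k] (G : Matrix k k (AdeleRing (𝓞 E) E))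
    (w : {w : InfinitePlace E // w.IsReal}) :
    (archMat E k G).det.1 w = Completion.extensionEmbeddingOfIsReal w.2 (G.det.1 w.1) := by
  have h : archMat E k G = ((InfiniteAdeleRing.ringEquiv_mixedSpace E).toRingHom.comp
      (RingHom.fst (InfiniteAdeleRing E) (FiniteAdeleRing (𝓞 E) E))).mapMatrix G := rfl
  rw [h, ← RingHom.map_det]
  rfl

omit [Algebra.IsQuadraticExtension F E] in
/-- **`modDelta (g,1)² = ∏_{w real} |det α_w| · ∏_{w complex} |det σ_w(α_w)|²`** for ANY `E`: the idelic modulus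
`|det_Δ (g,1)|_{𝔸_E}` of the archimedean Siegel element, `α = deltaBlock (g,1)` (finite part `1`).
[cite: Kudla1994, §3] [cite: HarrisKudlaSweet1996, §1 (1.15)] -/
theorem modDelta_archToAdelic_sq_eq_prod
    (g : arch F E c (n + n) (hermD F E e TV TW))
    (hu : IsUnit (detDelta F E c e TV TW (UnitaryGroup.archToAdelic F E c (n + n) (hermD F E e TV TW) g))) :
    modDelta F E c e TV TW (UnitaryGroup.archToAdelic F E c (n + n) (hermD F E e TV TW) g) ^ 2 =
      (∏ w : {w : InfinitePlace E // w.IsReal},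
          |(archMat E (Fin n) (deltaBlock F E c e TV TW (UnitaryGroup.archToAdelic F E c (n + n) (hermD F E e TV TW) g))).det.1 w|) *
        ∏ w : {w : InfinitePlace E // w.IsComplex},
          Complex.normSq (adeleMatAt E (Fin n) w (deltaBlock F E c e TV TW
            (UnitaryGroup.archToAdelic F E c (n + n) (hermD F E e TV TW) g))).det := by
  set p := UnitaryGroup.archToAdelic F E c (n + n) (hermD F E e TV TW) g with hp
  have hval : ((hu.unit : ideleGroup E) : AdeleRing (𝓞 E) E) = detDelta F E c e TV TW p := IsUnit.unit_spec hu
  have h2 : (detDelta F E c e TV TW p).2 = 1 :=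
    UnitaryDualPair.ArchSplitting.snd_det_deltaBlock_archToAdelic F E c (hermD F E e TV TW) g
  have hmod : ideleNorm hu.unit =
      (∏ w : {w : InfinitePlace E // w.IsReal}, |(archMat E (Fin n) (deltaBlock F E c e TV TW p)).det.1 w|) *
        ∏ w : {w : InfinitePlace E // w.IsComplex},
          Complex.normSq (adeleMatAt E (Fin n) w (deltaBlock F E c e TV TW p)).det := by
    unfold ideleNorm
    rw [hval, h2, finprod_eq_one_of_forall_eq_one fun v => by rw [show (1 : FiniteAdeleRing (𝓞 E) E) v = 1 from rfl, norm_one],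
      mul_one, prod_norm_pow_mult_eq_prod_abs_mul_prod_normSq]
    congr 1
    · refine Finset.prod_congr rfl fun w _ => ?_
      rw [det_archMat_fst]
      rfl
    · refine Finset.prod_congr rfl fun w _ => ?_
      rw [← adeleAt_apply, detDelta, RingHom.map_det, RingHom.mapMatrix_apply]
      rfl
  unfold modDelta
  rw [dif_pos hu, hmod]
  exact Real.sq_sqrt (mul_nonneg (Finset.prod_nonneg fun w _ => abs_nonneg _)
    (Finset.prod_nonneg fun w _ => Complex.normSq_nonneg _))

/-! ## §2 The signed modulus input `hdiagS`: `det A = (∏_{w real} sign det α_w) · modDelta (g,1)²` -/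

omit [NumberField F] [Field E] [NumberField E] [Algebra F E] [Algebra.IsQuadraticExtension F E] in
/-- a product of real numbers is the product of their signs times the product of their absolute values.
[cite: Kudla1994, §3] -/
theorem prod_eq_prod_sign_mul_prod_abs {ι : Type*} (s : Finset ι) (x : ι → ℝ) :
    ∏ i ∈ s, x i = (∏ i ∈ s, Real.sign (x i)) * ∏ i ∈ s, |x i| := by
  rw [← Finset.prod_mul_distrib]
  refine Finset.prod_congr rfl fun i _ => ?_
  rcases lt_trichotomy (x i) 0 with h | h | h
  · rw [Real.sign_of_neg h, abs_of_neg h]; ring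
  · rw [h, abs_zero, mul_zero]
  · rw [Real.sign_of_pos h, abs_of_pos h, one_mul]

omit [NumberField F] [Field E] [NumberField E] [Algebra F E] [Algebra.IsQuadraticExtension F E] in
/-- a product of signs of non-zero reals is `1` or `−1`. [cite: Kudla1994, §3] -/
theorem prod_sign_eq_one_or {ι : Type*} (s : Finset ι) (x : ι → ℝ) (hx : ∀ i ∈ s, x i ≠ 0) :
    ∏ i ∈ s, Real.sign (x i) = 1 ∨ ∏ i ∈ s, Real.sign (x i) = -1 := by
  induction s using Finset.induction_on with
  | empty => exact Or.inl Finset.prod_empty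
  | insert i s hi ih =>
    rw [Finset.prod_insert hi]
    have hi0 : x i ≠ 0 := hx i (Finset.mem_insert_self i s)
    have hs := ih fun j hj => hx j (Finset.mem_insert_of_mem hj)
    rcases lt_or_gt_of_ne hi0 with hneg | hpos
    · rw [Real.sign_of_neg hneg]
      rcases hs with h | h <;> rw [h] <;> norm_num
    · rw [Real.sign_of_pos hpos, one_mul]
      exact hs

include hd hV hW in
/-- **The archimedean Siegel parabolic acts on the diagonal through `Res(α)`, with SIGNED determinant
`det_ℝ = (∏_{w real} sign det α_w) · |det_Δ|_{𝔸_E}`** — general quadratic `E/F`, real places of `E` allowed (the `hdiagS`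
binder of `DoubledWeilRepresentationArchLiftReps.isArchHalf_twist_archLift_of_reps` at `jA := archToAdelic`, with
`sgnA g := ∏_{w real} sign ((archMat (deltaBlock (g,1))).det)_w`).  For `g ∈ U(J^𝔻)(F ⊗ ℝ)` with `(g, 1) ∈ P_Δ(𝔸)` there is
a real-linear automorphism `A` (`= archResLin (deltaBlock (g,1)) = Res_{(E⊗ℝ)/ℝ}(α_∞)`) of the archimedean pairs such that
`ι^𝔻(g, 1)` maps the diagonal pair of `(a, z)` to that of `A (a, z)` and
`det A = (∏_{w real} sign det α_w) · modDelta (g,1)²` (`det A = N_{(E⊗ℝ)/ℝ}(det α_∞) = ∏_{w real} det α_w · ∏_{w complex}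
|det α_w|²`).  For `E` totally complex the sign is the empty product `1`.
[cite: Kudla1994, §3] [cite: HarrisKudlaSweet1996, §1 (1.15)] [cite: GelbartRogawski1991, §3.1 Prop. 3.1.1 p. 455 L1–2] -/
theorem exists_archAct_diagPair_det_eq_sign_mul_modDelta_sq
    (g : arch F E c (n + n) (hermD F E e TV TW))
    (hS : IsSiegelDelta F E c e TV TW (UnitaryGroup.archToAdelic F E c (n + n) (hermD F E e TV TW) g)) :
    ∃ A : ((Fin n → mixedSpace F) × (Fin n → mixedSpace F)) ≃ₗ[ℝ]
        ((Fin n → mixedSpace F) × (Fin n → mixedSpace F)),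
      (∀ az : (Fin n → mixedSpace F) × (Fin n → mixedSpace F),
        archAct (gramDA F e TV TW)
            (toSpD F E c hcδ hδ hd e TV hV TW hW (UnitaryGroup.archToAdelic F E c (n + n) (hermD F E e TV TW) g))
            (Sum.elim az.1 az.1 ∘ ⇑(e₂ (n := n)).symm, Sum.elim az.2 az.2 ∘ ⇑(e₂ (n := n)).symm) =
          (Sum.elim (A az).1 (A az).1 ∘ ⇑(e₂ (n := n)).symm, Sum.elim (A az).2 (A az).2 ∘ ⇑(e₂ (n := n)).symm)) ∧
      ((LinearMap.det (A : ((Fin n → mixedSpace F) × (Fin n → mixedSpace F)) →ₗ[ℝ]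
          ((Fin n → mixedSpace F) × (Fin n → mixedSpace F))) : ℝ) : ℂ) =
        ((∏ w : {w : InfinitePlace E // w.IsReal},
            Real.sign ((archMat E (Fin n) (deltaBlock F E c e TV TW
              (UnitaryGroup.archToAdelic F E c (n + n) (hermD F E e TV TW) g))).det.1 w) : ℝ) : ℂ) *
          ((modDelta F E c e TV TW (UnitaryGroup.archToAdelic F E c (n + n) (hermD F E e TV TW) g) : ℝ) : ℂ) ^ 2 := by
  set p := UnitaryGroup.archToAdelic F E c (n + n) (hermD F E e TV TW) g with hp
  have hu : IsUnit (detDelta F E c e TV TW p) := isUnit_detDelta_of_isSiegelDelta F E c e TV TW p hS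
  have hdetR : ∀ w : {w : InfinitePlace E // w.IsReal},
      (archMat E (Fin n) (deltaBlock F E c e TV TW p)).det.1 w ≠ 0 := by
    intro w
    rw [det_archMat_fst]
    have h1 : Completion.extensionEmbeddingOfIsReal w.2 ((deltaBlock F E c e TV TW p).det.1 w.1) =
        ((Completion.extensionEmbeddingOfIsReal w.2).comp
          ((Pi.evalRingHom (fun w : InfinitePlace E => w.Completion) w.1).comp
            (RingHom.fst (InfiniteAdeleRing E) (FiniteAdeleRing (𝓞 E) E)))) (detDelta F E c e TV TW p) := rfl
    rw [h1]
    exact (hu.map _).ne_zero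
  have hdetC : ∀ w : {w : InfinitePlace E // w.IsComplex},
      (adeleMatAt E (Fin n) w (deltaBlock F E c e TV TW p)).det ≠ 0 := by
    intro w
    have h1 : (adeleMatAt E (Fin n) w (deltaBlock F E c e TV TW p)).det = adeleAt E w (detDelta F E c e TV TW p) := by
      unfold adeleMatAt detDelta
      rw [RingHom.map_det, RingHom.mapMatrix_apply]
    rw [h1]
    exact (hu.map (adeleAt E w)).ne_zero
  have hdet := det_archResLin_eq_prod F E c hcδ hδ (Fin n) (deltaBlock F E c e TV TW p)
  have hne : LinearMap.det (archResLin F E c hcδ hδ (Fin n) (deltaBlock F E c e TV TW p)) ≠ 0 :=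
    det_archResLin_ne_zero F E c hcδ hδ (Fin n) (deltaBlock F E c e TV TW p) hdetR hdetC
  have hU : IsUnit (archResLin F E c hcδ hδ (Fin n) (deltaBlock F E c e TV TW p)) :=
    (LinearMap.isUnit_iff_isUnit_det _).2 (isUnit_iff_ne_zero.2 hne)
  refine ⟨LinearMap.GeneralLinearGroup.generalLinearEquiv ℝ _ hU.unit, fun az => ?_, ?_⟩
  · have hA : (LinearMap.GeneralLinearGroup.generalLinearEquiv ℝ _ hU.unit) az =
        archResLin F E c hcδ hδ (Fin n) (deltaBlock F E c e TV TW p) az := rfl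
    rw [hA, archResLin_apply]
    exact archAct_toSpD_diagPair F E c hcδ hδ hd e TV hV TW hW p hS az
  · rw [LinearMap.GeneralLinearGroup.generalLinearEquiv_to_linearMap, IsUnit.unit_spec, hdet, ← Complex.ofReal_pow,
      modDelta_archToAdelic_sq_eq_prod F E c e TV TW g hu, ← Complex.ofReal_mul,
      prod_eq_prod_sign_mul_prod_abs Finset.univ, mul_assoc]

omit [Algebra.IsQuadraticExtension F E] in
/-- the sign `∏_{w real} sign det α_w` of `exists_archAct_diagPair_det_eq_sign_mul_modDelta_sq` is `1` or `−1` on `P_Δ`.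
[cite: Kudla1994, §3] -/
theorem prod_sign_det_deltaBlock_eq_one_or
    (g : arch F E c (n + n) (hermD F E e TV TW))
    (hS : IsSiegelDelta F E c e TV TW (UnitaryGroup.archToAdelic F E c (n + n) (hermD F E e TV TW) g)) :
    (∏ w : {w : InfinitePlace E // w.IsReal},
        Real.sign ((archMat E (Fin n) (deltaBlock F E c e TV TW
          (UnitaryGroup.archToAdelic F E c (n + n) (hermD F E e TV TW) g))).det.1 w)) = 1 ∨
      (∏ w : {w : InfinitePlace E // w.IsReal},
        Real.sign ((archMat E (Fin n) (deltaBlock F E c e TV TW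
          (UnitaryGroup.archToAdelic F E c (n + n) (hermD F E e TV TW) g))).det.1 w)) = -1 := by
  have hu : IsUnit (detDelta F E c e TV TW (UnitaryGroup.archToAdelic F E c (n + n) (hermD F E e TV TW) g)) :=
    isUnit_detDelta_of_isSiegelDelta F E c e TV TW _ hS
  refine prod_sign_eq_one_or Finset.univ _ fun w _ => ?_
  rw [det_archMat_fst]
  exact (hu.map ((Completion.extensionEmbeddingOfIsReal w.2).comp
    ((Pi.evalRingHom (fun w : InfinitePlace E => w.Completion) w.1).comp
      (RingHom.fst (InfiniteAdeleRing E) (FiniteAdeleRing (𝓞 E) E))))).ne_zero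

end Literature.NumberTheory.GelbartRogawski1991.GRConstructionGen

end
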